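import Mathlib

/-!
# LINE `valuative_door` (crux `WeakLifting`, stmt-ValiantsHypothesis-19561) — toward the support stub `stub_symmetryVoid`
# (`SymmetryVoid : ValRootLawAt (2m) K B → GenValRootLawAt m K B`): DOMINANT EXPONENTS SURVIVE SQUARING (non-archimedean `v`)

HONEST FRAMING.  Helper (cell `pub-symmetroid`, seat val-sym-lift-p1 g21, 2026-08-29; `--supports 19561 --as helper`).  The line's
«symmetry is void» reduction embeds a general `m × m` lacunary pencil `P` into the symmetric `2m × 2m` pencil `fromBlocks 0 P Pᵀ 0`,
whose determinant is `± (det P)²`; to pull the symmetric census row back one needs that the skeleton's `domCount` does not DROP under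
`f ↦ c · f²` (`c ≠ 0`).  This file proves exactly that, def-free on the raw `domCount` predicate: for a NON-ARCHIMEDEAN absolute value
`v`, if the exponent `E` of `f` strictly dominates at the radius `r`, then `2E` is in the support of `f ^ 2` and strictly dominates there
at the same radius (`v ((f²)_{2E}) = v (f_E)²` by the ultrametric equality case, every other coefficient of `f²` is bounded by a product
of two weighted terms of which at least one is strictly smaller); hence `E ↦ 2E` injects the dominant exponents of `f` into those of
`f ^ 2` and the count does not drop (`card_dominant_le_card_dominant_sq`); and `C c * f` (`c ≠ 0`) has the same dominant exponents as
`f` (`dominant_C_mul`).  The block-determinant identity and the `Fin (2m)` reindexing of `SymmetryVoid` are NOT done here (successor).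
Nothing here is a stub of the line, closes anything, or bears on vW / vB / `ValRankOneLaw`, `TropicalB`, `MatrixDescartes` (18050) or
VP ≠ VNP.  [elementary; ultrametric bookkeeping via `IsNonarchimedean.apply_sum_eq_of_lt` / `finset_image_add_of_nonempty`]
-/

set_option linter.dupNamespace false
set_option autoImplicit false

namespace Summit.ValiantsHypothesis.ValiantsHypothesis.Theorems.KPlusLogSqLaw.ValDoor

open Polynomial Finset
open scoped BigOperators Classical

variable {F : Type*} [Field F]

/-- **the square of a dominant term dominates the square.**  If `E` strictly dominates `f` at the radius `r > 0` (against every other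
support exponent), then for NON-ARCHIMEDEAN `v`: `v ((f ^ 2).coeff (2 E)) = v (f.coeff E) ^ 2`, so `2 E ∈ (f ^ 2).support`, and `2 E`
strictly dominates `f ^ 2` at the same radius. [elementary, ultrametric] -/
theorem dominant_sq (v : AbsoluteValue F ℝ) (hv : IsNonarchimedean v) (f : F[X]) {E : ℕ} {r : ℝ} (hr : 0 < r)
    (hE : E ∈ f.support) (hdom : ∀ E' ∈ f.support, E' ≠ E → v (f.coeff E') * r ^ E' < v (f.coeff E) * r ^ E) :
    v ((f ^ 2).coeff (2 * E)) = v (f.coeff E) ^ 2 ∧ 2 * E ∈ (f ^ 2).support ∧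
      ∀ G ∈ (f ^ 2).support, G ≠ 2 * E → v ((f ^ 2).coeff G) * r ^ G < v ((f ^ 2).coeff (2 * E)) * r ^ (2 * E) := by
  -- weighted terms and the domination of every index ≠ E (support or not)
  have hwE : 0 < v (f.coeff E) * r ^ E := mul_pos (v.pos (Polynomial.mem_support_iff.1 hE)) (pow_pos hr E)
  have hdom' : ∀ a : ℕ, a ≠ E → v (f.coeff a) * r ^ a < v (f.coeff E) * r ^ E := by
    intro a ha
    by_cases has : a ∈ f.support
    · exact hdom a has ha
    · rw [Polynomial.notMem_support_iff.1 has, map_zero, zero_mul]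
      exact hwE
  have hnonneg : ∀ a : ℕ, 0 ≤ v (f.coeff a) * r ^ a := fun a => mul_nonneg (v.nonneg _) (pow_nonneg hr.le a)
  -- product of two weighted terms: strictly below the square unless both indices are E
  have hprod : ∀ a b : ℕ, ¬ (a = E ∧ b = E) →
      (v (f.coeff a) * r ^ a) * (v (f.coeff b) * r ^ b) < (v (f.coeff E) * r ^ E) * (v (f.coeff E) * r ^ E) := by
    intro a b hab
    by_cases ha : a = E
    · have hb : b ≠ E := fun hb => hab ⟨ha, hb⟩
      rw [ha]
      exact mul_lt_mul_of_pos_left (hdom' b hb) hwE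
    · rcases eq_or_ne b E with hb | hb
      · rw [hb]
        exact mul_lt_mul_of_pos_right (hdom' a ha) hwE
      · exact mul_lt_mul'' (hdom' a ha) (hdom' b hb) (hnonneg a) (hnonneg b)
  have hsq : f ^ 2 = f * f := sq f
  -- the coefficient of the square at 2E: ultrametric equality case
  have hcoeff2E : v ((f ^ 2).coeff (2 * E)) = v (f.coeff E) ^ 2 := by
    rw [hsq, Polynomial.coeff_mul]
    have hk : (E, E) ∈ HasAntidiagonal.antidiagonal (2 * E) := by
      rw [HasAntidiagonal.mem_antidiagonal, two_mul]
    rw [IsNonarchimedean.apply_sum_eq_of_lt hv (fun a => (v.map_neg a).symm) hk ?_]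
    · rw [map_mul, sq]
    · intro x hx hne
      rw [HasAntidiagonal.mem_antidiagonal] at hx
      have hxE : ¬ (x.1 = E ∧ x.2 = E) := fun h => hne (Prod.ext h.1 h.2)
      have h1 := hprod x.1 x.2 hxE
      rw [map_mul, map_mul]
      have hr2 : r ^ x.1 * r ^ x.2 = r ^ E * r ^ E := by
        rw [← pow_add, ← pow_add, hx, two_mul]
      have hpos : 0 < r ^ E * r ^ E := by positivity
      have h1' : v (f.coeff x.1) * v (f.coeff x.2) * (r ^ x.1 * r ^ x.2)
          < v (f.coeff E) * v (f.coeff E) * (r ^ E * r ^ E) := by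
        calc v (f.coeff x.1) * v (f.coeff x.2) * (r ^ x.1 * r ^ x.2)
            = (v (f.coeff x.1) * r ^ x.1) * (v (f.coeff x.2) * r ^ x.2) := by ring
          _ < (v (f.coeff E) * r ^ E) * (v (f.coeff E) * r ^ E) := h1
          _ = v (f.coeff E) * v (f.coeff E) * (r ^ E * r ^ E) := by ring
      rw [hr2] at h1'
      exact lt_of_mul_lt_mul_right h1' hpos.le
  have hmem : 2 * E ∈ (f ^ 2).support := by
    rw [Polynomial.mem_support_iff]
    intro h0
    have h1 := hcoeff2E
    rw [h0, map_zero] at h1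
    exact (pow_pos (v.pos (Polynomial.mem_support_iff.1 hE)) 2).ne h1
  refine ⟨hcoeff2E, hmem, fun G hG hne => ?_⟩
  -- every other coefficient of the square is bounded by ONE product of the antidiagonal (ultrametric)
  have hne' : (HasAntidiagonal.antidiagonal G).Nonempty := ⟨(0, G), by rw [HasAntidiagonal.mem_antidiagonal, zero_add]⟩
  obtain ⟨x, hx, hle⟩ :=
    IsNonarchimedean.finset_image_add_of_nonempty hv (fun x : ℕ × ℕ => f.coeff x.1 * f.coeff x.2) hne'
  rw [HasAntidiagonal.mem_antidiagonal] at hx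
  have hcG : (f ^ 2).coeff G = ∑ x ∈ HasAntidiagonal.antidiagonal G, f.coeff x.1 * f.coeff x.2 := by
    rw [hsq, Polynomial.coeff_mul]
  have hxE : ¬ (x.1 = E ∧ x.2 = E) := by
    rintro ⟨h1, h2⟩
    apply hne
    rw [← hx, h1, h2, two_mul]
  have h1 := hprod x.1 x.2 hxE
  calc v ((f ^ 2).coeff G) * r ^ G ≤ v (f.coeff x.1 * f.coeff x.2) * r ^ G := by
        rw [hcG]
        exact mul_le_mul_of_nonneg_right hle (pow_nonneg hr.le G)
    _ = (v (f.coeff x.1) * r ^ x.1) * (v (f.coeff x.2) * r ^ x.2) := by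
        rw [map_mul, ← hx, pow_add]; ring
    _ < (v (f.coeff E) * r ^ E) * (v (f.coeff E) * r ^ E) := h1
    _ = v ((f ^ 2).coeff (2 * E)) * r ^ (2 * E) := by
        rw [hcoeff2E, two_mul, pow_add]; ring

/-- **SQUARING DOES NOT DROP THE DOMINANT-EXPONENT COUNT** (non-archimedean `v`): `E ↦ 2E` injects the exponents of `f` that
strictly dominate at some radius into those of `f ^ 2` — the skeleton's `domCount v f ≤ domCount v (f ^ 2)`, spelled on the raw
predicate. [elementary] -/
theorem card_dominant_le_card_dominant_sq (v : AbsoluteValue F ℝ) (hv : IsNonarchimedean v) (f : F[X]) :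
    (f.support.filter fun E => ∃ r : ℝ, 0 < r ∧ ∀ E' ∈ f.support, E' ≠ E →
        v (f.coeff E') * r ^ E' < v (f.coeff E) * r ^ E).card
      ≤ ((f ^ 2).support.filter fun E => ∃ r : ℝ, 0 < r ∧ ∀ E' ∈ (f ^ 2).support, E' ≠ E →
          v ((f ^ 2).coeff E') * r ^ E' < v ((f ^ 2).coeff E) * r ^ E).card := by
  refine Finset.card_le_card_of_injOn (fun E => 2 * E) (fun E hE => ?_) (fun a _ b _ h => ?_)
  · obtain ⟨hEs, r, hr, hdom⟩ := Finset.mem_filter.1 hE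
    obtain ⟨_, hmem, hdom2⟩ := dominant_sq v hv f hr hEs hdom
    exact Finset.mem_filter.2 ⟨hmem, r, hr, hdom2⟩
  · have h' : 2 * a = 2 * b := h
    omega

/-- **a nonzero constant factor does not change the dominant exponents** (any absolute value). [bookkeeping] -/
theorem dominant_C_mul (v : AbsoluteValue F ℝ) (f : F[X]) {c : F} (hc : c ≠ 0) :
    ((C c * f).support.filter fun E => ∃ r : ℝ, 0 < r ∧ ∀ E' ∈ (C c * f).support, E' ≠ E →
        v ((C c * f).coeff E') * r ^ E' < v ((C c * f).coeff E) * r ^ E)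
      = (f.support.filter fun E => ∃ r : ℝ, 0 < r ∧ ∀ E' ∈ f.support, E' ≠ E →
          v (f.coeff E') * r ^ E' < v (f.coeff E) * r ^ E) := by
  have hs : (C c * f).support = f.support := by
    ext n
    simp only [Polynomial.mem_support_iff, Polynomial.coeff_C_mul, ne_eq, mul_eq_zero, hc, false_or]
  have hvc : 0 < v c := v.pos hc
  rw [hs]
  refine Finset.filter_congr fun E _ => ?_
  simp only [Polynomial.coeff_C_mul, map_mul, mul_assoc]
  constructor
  · rintro ⟨r, hr, h⟩
    exact ⟨r, hr, fun E' hE' hne => lt_of_mul_lt_mul_left (h E' hE' hne) hvc.le⟩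
  · rintro ⟨r, hr, h⟩
    exact ⟨r, hr, fun E' hE' hne => mul_lt_mul_of_pos_left (h E' hE' hne) hvc⟩

/-- corollary: the count for `C c * f ^ 2` (`c ≠ 0`, e.g. the sign `(-1)^m` of an anti-block-diagonal determinant) is at least the count
for `f`. [assembly of the two lemmas] -/
theorem card_dominant_le_card_dominant_C_mul_sq (v : AbsoluteValue F ℝ) (hv : IsNonarchimedean v) (f : F[X]) {c : F} (hc : c ≠ 0) :
    (f.support.filter fun E => ∃ r : ℝ, 0 < r ∧ ∀ E' ∈ f.support, E' ≠ E →
        v (f.coeff E') * r ^ E' < v (f.coeff E) * r ^ E).card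
      ≤ ((C c * f ^ 2).support.filter fun E => ∃ r : ℝ, 0 < r ∧ ∀ E' ∈ (C c * f ^ 2).support, E' ≠ E →
          v ((C c * f ^ 2).coeff E') * r ^ E' < v ((C c * f ^ 2).coeff E) * r ^ E).card := by
  rw [dominant_C_mul v (f ^ 2) hc]
  exact card_dominant_le_card_dominant_sq v hv f

end Summit.ValiantsHypothesis.ValiantsHypothesis.Theorems.KPlusLogSqLaw.ValDoor
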